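import Literature.Analysis.FluidPDE.StokesWholeSpacePressure
import HarnessLib

/-!
# The whole-space Stokes system: the a priori `L^p` estimate (Cattabriga), given Stein's Prop. 3

Analysis/FluidPDE support file on the decomposition path of the named fact
`Literature.Analysis.FluidPDE.stokes_interior_Lr_estimate` (`FluidPDE/StokesInteriorEstimate`;
T.-P. Tsai, Arch. Rational Mech. Anal. 143 (1998), §3.2 display (3.2): the interior `L^r`
estimate for the Stokes system, "[Ga I p. 208]" = Galdi, Vol. I / Cattabriga 1961). The interior
estimate follows (next file) by a cutoff from the **whole-space a priori estimate**, which this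
file PROVES from the tree's single Calderón–Zygmund primitive, the named fact
`stein1970_hessian_Lp_bound` (Stein 1970, Ch. III §1.3 Prop. 3, `FluidPDE/HessianLaplacianLp`):

* `stokes_wholeSpace_Lp_estimate`: for `ν > 0` and `1 < p < ∞` there is `C = C(ν, p)` such that
  for every `w ∈ C²(ℝ³; ℝ³)` and `σ ∈ C¹(ℝ³)` with compact support,
  `‖D²w‖_{L^p(ℝ³)} + ‖∇σ‖_{L^p(ℝ³)} ≤ C (‖νΔw - ∇σ‖_{L^p(ℝ³)} + ‖∇ div w‖_{L^p(ℝ³)})`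
  (`D²w = iteratedFDeriv ℝ 2 w` with its operator norm, `∇σ = fderiv ℝ σ`,
  `∇ div w = fderiv ℝ (div w)`), the classical `L^p` theory of the Stokes system
  `νΔw - ∇σ = F`, `div w = g` in `ℝ³` in a priori form (Cattabriga 1961; Galdi 2011, Ch. IV §IV.2).

Proof. With `F = νΔw - ∇σ`, `g = div w`, `σ' = σ - νg`: the pressure estimate of
`FluidPDE/StokesWholeSpacePressure` gives `‖∇σ'‖_p ≤ 3C_P ‖F‖_p`, hence
`‖∇σ‖_p ≤ 3C_P‖F‖_p + ν‖∇g‖_p`; the velocity estimate is Stein's Proposition 3 for vector fields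
(`stein1970_hessian_Lp_bound.iteratedFDeriv_two`, `FluidPDE/HessianLpVector`) applied to
`w ∈ C²_c` directly: `‖D²w‖_p ≤ A‖Δw‖_p = A ν⁻¹ ‖F + ∇σ‖_p`.

## References

* E. M. Stein, *Singular integrals and differentiability properties of functions* (1970),
  Ch. III §1.3 Prop. 3 [Stein1971].
* G. P. Galdi, *An introduction to the mathematical theory of the Navier–Stokes equations*,
  2nd ed. (2011), Ch. IV §IV.2 (whole space), §IV.4 Thm IV.4.1 (interior) [Galdi2011] (not
  held); L. Cattabriga, Rend. Sem. Mat. Univ. Padova 31 (1961) 308–340.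
* T.-P. Tsai, Arch. Rational Mech. Anal. 143 (1998), §3.2 (3.2) p. 37 [Tsai1998].
-/

noncomputable section

open MeasureTheory Set Filter Function Metric InnerProductSpace
open scoped ENNReal NNReal RealInnerProductSpace Laplacian ContDiff

namespace Literature.Analysis.FluidPDE

/-- The `L^p` norms of `fderiv ℝ σ` and of `gradient σ` agree (the Riesz isometry). [folklore] -/
theorem eLpNorm_fderiv_eq_eLpNorm_gradient {E : Type*} [NormedAddCommGroup E]
    [InnerProductSpace ℝ E] [CompleteSpace E] [MeasurableSpace E] (μ : Measure E) (σ : E → ℝ)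
    (p : ℝ≥0∞) :
    eLpNorm (fun x => fderiv ℝ σ x) p μ = eLpNorm (gradient σ) p μ :=
  eLpNorm_congr_norm_ae (Eventually.of_forall fun x => by
    rw [gradient, LinearIsometryEquiv.norm_map])

/-- **The whole-space a priori `L^p` estimate for the Stokes system** (Cattabriga 1961; Galdi
2011, Ch. IV §IV.2), *given Stein's Proposition 3* (`stein1970_hessian_Lp_bound`): for `ν > 0` and
`1 < p < ∞` there is `C = C(ν, p)` such that for all `w ∈ C²(ℝ³; ℝ³)`, `σ ∈ C¹(ℝ³)` with compact
support,
`‖D²w‖_{L^p} + ‖∇σ‖_{L^p} ≤ C (‖νΔw - ∇σ‖_{L^p} + ‖∇(div w)‖_{L^p})`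
(all norms over `ℝ³`; `D²w(x) = iteratedFDeriv ℝ 2 w x` with the operator norm). The body force
`F = νΔw - ∇σ` and `g = div w` are *defined* from the pair, so this is the estimate for every
classical compactly supported solution of `νΔw - ∇σ = F`, `div w = g`. PROVED from the named
fact (pressure: `stokes_pressure_Lp_estimate`; velocity: Stein's Prop. 3 for vector fields).
[cite: Stein1971, Ch. III §1.3 Prop 3] -/
theorem stokes_wholeSpace_Lp_estimate (h : stein1970_hessian_Lp_bound (EuclideanSpace ℝ (Fin 3)))
    {ν : ℝ} (hν : 0 < ν) {p : ℝ≥0∞} (hp : 1 < p) (hp' : p < ⊤) :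
    ∃ C : ℝ≥0, ∀ (w : EuclideanSpace ℝ (Fin 3) → EuclideanSpace ℝ (Fin 3))
      (σ : EuclideanSpace ℝ (Fin 3) → ℝ), ContDiff ℝ 2 w → HasCompactSupport w →
      ContDiff ℝ 1 σ → HasCompactSupport σ →
        eLpNorm (fun x => iteratedFDeriv ℝ 2 w x) p volume +
            eLpNorm (fun x => fderiv ℝ σ x) p volume ≤
          C * (eLpNorm (fun x => ν • (Δ w) x - gradient σ x) p volume +
            eLpNorm (fun x => fderiv ℝ (VectorCalculus.divergence w) x) p volume) := by
  obtain ⟨A, hA⟩ := h.iteratedFDeriv_two hp hp'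
  obtain ⟨CP, hCP⟩ := stokes_pressure_Lp_estimate h hp hp'
  set eb := EuclideanSpace.basisFun (Fin 3) ℝ with heb
  set νn : ℝ≥0 := ‖ν‖₊ with hνn
  set νi : ℝ≥0 := ‖ν⁻¹‖₊ with hνi
  refine ⟨A * νi * (1 + 3 * CP) + 3 * CP + (A * νi * νn + νn), fun w σ hw hwc hσ hσc => ?_⟩
  -- work with gradients (Riesz isometry) rather than `fderiv`
  rw [eLpNorm_fderiv_eq_eLpNorm_gradient volume σ p,
    eLpNorm_fderiv_eq_eLpNorm_gradient volume (VectorCalculus.divergence w) p]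
  -- the objects
  set F : EuclideanSpace ℝ (Fin 3) → EuclideanSpace ℝ (Fin 3) :=
    fun x => ν • (Δ w) x - gradient σ x with hF
  set G : EuclideanSpace ℝ (Fin 3) → EuclideanSpace ℝ (Fin 3) :=
    gradient (VectorCalculus.divergence w) with hG
  set σ' : EuclideanSpace ℝ (Fin 3) → ℝ := fun y => σ y - ν * VectorCalculus.divergence w y
    with hσ'
  have hdiv1 : ContDiff ℝ 1 (VectorCalculus.divergence w) :=
    contDiff_divergence (n := 1) (by exact_mod_cast hw)
  have hσ'1 : ContDiff ℝ 1 σ' := hσ.sub (contDiff_const.mul hdiv1)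
  have hσd : ∀ x, DifferentiableAt ℝ σ x := fun x => hσ.differentiable one_ne_zero x
  have hdivd : ∀ x, DifferentiableAt ℝ (VectorCalculus.divergence w) x := fun x =>
    hdiv1.differentiable one_ne_zero x
  -- measurability
  have hFm : AEStronglyMeasurable F volume :=
    (((continuous_laplacian hw).const_smul ν).sub
      (continuous_gradient_of_contDiff hσ)).aestronglyMeasurable
  have hGm : AEStronglyMeasurable G volume :=
    (continuous_gradient_of_contDiff hdiv1).aestronglyMeasurable
  have hgσm : AEStronglyMeasurable (gradient σ) volume :=
    (continuous_gradient_of_contDiff hσ).aestronglyMeasurable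
  have hgσ'm : AEStronglyMeasurable (gradient σ') volume :=
    (continuous_gradient_of_contDiff hσ'1).aestronglyMeasurable
  have hνGm : AEStronglyMeasurable (fun x => ν • G x) volume := hGm.const_smul ν
  -- (1) the modified pressure: `‖∇σ'‖_p ≤ 3 C_P ‖F‖_p`
  have h1 : eLpNorm (gradient σ') p volume ≤ ↑(3 * CP) * eLpNorm F p volume := by
    refine (eLpNorm_gradient_le_sum eb hσ'1 p hp.le).trans ?_
    calc ∑ i, eLpNorm (fun x => fderiv ℝ σ' x (eb i)) p volume
        ≤ ∑ _i : Fin 3, (CP : ℝ≥0∞) * eLpNorm F p volume :=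
          Finset.sum_le_sum fun i _ => hCP ν w σ hw hwc hσ hσc (eb i) (eb.orthonormal.1 i).le
      _ = ↑(3 * CP) * eLpNorm F p volume := by
          simp only [Finset.sum_const, Finset.card_univ, Fintype.card_fin, nsmul_eq_mul]
          push_cast
          ring
  -- (2) the pressure: `∇σ = ∇σ' + ν ∇g`
  have h2 : eLpNorm (gradient σ) p volume ≤
      eLpNorm (gradient σ') p volume + νn * eLpNorm G p volume := by
    have e : gradient σ = gradient σ' + fun x => ν • G x := by
      funext x
      have hx : fderiv ℝ σ' x = fderiv ℝ σ x - ν • fderiv ℝ (VectorCalculus.divergence w) x := by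
        simp only [hσ']
        rw [fderiv_fun_sub (hσd x) ((hdivd x).const_mul ν), fderiv_const_mul (hdivd x)]
      have hx' : gradient σ' x = gradient σ x - ν • G x := by
        simp only [gradient, hx, map_sub, map_smul, hG]
      simp only [Pi.add_apply, hx', sub_add_cancel]
    have hadd : eLpNorm (gradient σ' + fun x => ν • G x) p volume ≤
        eLpNorm (gradient σ') p volume + eLpNorm (fun x => ν • G x) p volume :=
      eLpNorm_add_le hgσ'm hνGm hp.le
    have hsm : eLpNorm (fun x => ν • G x) p volume ≤ νn * eLpNorm G p volume := by
      have hcs : eLpNorm (ν • G) p volume ≤ ‖ν‖ₑ * eLpNorm G p volume := eLpNorm_const_smul_le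
      rwa [enorm_eq_nnnorm] at hcs
    rw [e]
    exact hadd.trans (add_le_add le_rfl hsm)
  -- (3) the Laplacian: `Δw = ν⁻¹ (F + ∇σ)`
  have h3 : eLpNorm (Δ w) p volume ≤
      νi * (eLpNorm F p volume + eLpNorm (gradient σ) p volume) := by
    have e : Δ w = ν⁻¹ • (F + gradient σ) := by
      funext x
      simp only [hF, Pi.smul_apply, Pi.add_apply, sub_add_cancel, smul_smul,
        inv_mul_cancel₀ hν.ne', one_smul]
    have hcs : eLpNorm (ν⁻¹ • (F + gradient σ)) p volume ≤
        ‖ν⁻¹‖ₑ * eLpNorm (F + gradient σ) p volume := eLpNorm_const_smul_le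
    have hadd : eLpNorm (F + gradient σ) p volume ≤
        eLpNorm F p volume + eLpNorm (gradient σ) p volume := eLpNorm_add_le hFm hgσm hp.le
    rw [enorm_eq_nnnorm] at hcs
    rw [e]
    exact hcs.trans (by gcongr)
  -- (4) the velocity: Stein's Proposition 3 for vector fields
  have h4 : eLpNorm (fun x => iteratedFDeriv ℝ 2 w x) p volume ≤ A * eLpNorm (Δ w) p volume :=
    hA w hw hwc
  -- assembly
  set a := eLpNorm F p volume with ha
  set g := eLpNorm G p volume with hg
  set s' := eLpNorm (gradient σ') p volume with hs'
  calc eLpNorm (fun x => iteratedFDeriv ℝ 2 w x) p volume + eLpNorm (gradient σ) p volume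
      ≤ A * eLpNorm (Δ w) p volume + (s' + νn * g) := add_le_add h4 h2
    _ ≤ A * (νi * (a + (s' + νn * g))) + (s' + νn * g) := by
        gcongr
        exact h3.trans (by gcongr)
    _ ≤ A * (νi * (a + (↑(3 * CP) * a + νn * g))) + (↑(3 * CP) * a + νn * g) := by gcongr
    _ = ↑(A * νi * (1 + 3 * CP) + 3 * CP) * a + ↑(A * νi * νn + νn) * g := by
        push_cast
        ring
    _ ≤ ↑(A * νi * (1 + 3 * CP) + 3 * CP + (A * νi * νn + νn)) * a +
          ↑(A * νi * (1 + 3 * CP) + 3 * CP + (A * νi * νn + νn)) * g := by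
        have hc1 : ((A * νi * (1 + 3 * CP) + 3 * CP : ℝ≥0) : ℝ≥0∞) ≤
            ↑(A * νi * (1 + 3 * CP) + 3 * CP + (A * νi * νn + νn)) := by
          exact_mod_cast le_self_add
        have hc2 : ((A * νi * νn + νn : ℝ≥0) : ℝ≥0∞) ≤
            ↑(A * νi * (1 + 3 * CP) + 3 * CP + (A * νi * νn + νn)) := by
          exact_mod_cast le_add_self
        exact add_le_add (mul_le_mul_of_nonneg_right hc1 (by simp))
          (mul_le_mul_of_nonneg_right hc2 (by simp))
    _ = ↑(A * νi * (1 + 3 * CP) + 3 * CP + (A * νi * νn + νn)) * (a + g) := (mul_add _ _ _).symm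

end Literature.Analysis.FluidPDE

end
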